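import Summits.ResolutionOfSingularities.ResolutionOfSingularities.Theorems.FrobeniusLadderFRationalResolutionOffSupportDegrees
import Summits.ResolutionOfSingularities.ResolutionOfSingularities.Theorems.FrobeniusLadderFRationalResolutionGradedQuotientFree
import Summits.ResolutionOfSingularities.ResolutionOfSingularities.Theorems.FrobeniusLadderFRationalResolutionFlatPrimeDescent
import Literature.RingTheory.GradedAlgebra.LocalizationDegreeZero
import Literature.AlgebraicGeometry.Resolution.NagataCriterion
import Mathlib.RingTheory.Localization.Away.Basic
import HarnessLib

/-!
# Crux `FrobeniusLadder.FRationalResolution` (stmt-ResolutionOfSingularities-15317), line `redirect`,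
# stub `stub_diagonalizableQuotientResolution` — step (e-asm), L-side: on the localization `L = S_e`
# of the chart ring where the surviving parameters are units, the stratum quotient `L/(x_I)L` is
# FLAT over the degree-zero quotient, so regularity of the stratum at a prime descends to the
# degree-zero side (memo MEMO-15317-leafhand2-g3 §6–§7)

Data: `S` graded of finite type over a field, `x₁,…,x_n` homogeneous of degrees `aᵢ`, `I ⊆ {1..n}`,
`g ∈ S₀` with `g • S ⊆ S₀[x]` (`…FixedPointMonomialNhd`), and `e ∈ S₀` divisible by `g` and by every
`x_j`, `j ∉ I`. On `L = S[e⁻¹]`, graded by `locPiece` (Literature `LocalizationDegreeZero`), the ideal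
`(x_I)L` is homogeneous, the degrees `Σ_{j∉I} m_j a_j` carry the unit monomials `x^m`, and every
other degree is swallowed by `(x_I)L` (`…OffSupportDegrees`); hence `…GradedQuotientFree.flat_quotient`
applies with `R₀ = L₀` and `…FlatPrimeDescent.isRegularLocalRing_atPrime_of_flat` descends regularity.

* `powers_le_gradeZero` — powers of a degree-zero element have degree zero;
* **`flat_stratum_quotient`** — `L ⧸ (x_I)L` is FLAT over `L₀ ⧸ ((x_I)L ∩ L₀)` (`L₀ = locPiece … 0`).

With `…FlatPrimeDescent.isRegularLocalRing_atPrime_of_flat` this descends regularity of the stratum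
`(L/(x_I)L)_𝔓̄` to `(L₀/((x_I)L ∩ L₀))_{𝔓̄ ∩ L₀}`; that application and the transport from
`L₀ = (S₀)_e` to `(S₀)_𝔮'` (steps (e-asm, end)/(asm) of the memo) remain — NOTE for them: do not let
typeclass search build `Localization.AtPrime q ⧸ _` or `algebraMap (L₀ ⧸ J) (L ⧸ I_L)` over
`L₀ = ↥(locPiece … 0)` (instance diamonds on grade-zero subtypes); use `Ideal.quotientMap` terms and
the `Localization.AtPrime (q.map (Ideal.Quotient.mk J))` form instead.

Honest label: assembly brick (no stub closed). No definitions, no named facts,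
no sorry. [folklore; cite: Kato1994, Prop. (7.1)] [cite: Matsumura1987, Thm. 23.7 (i)]
-/

noncomputable section

-- single-problem summit: the doubled namespace component is forced
set_option linter.dupNamespace false

open DirectSum Literature.RingTheory.GradedAlgebra
open Literature.AlgebraicGeometry.Resolution.DiagonalizableQuotient

namespace Summit.ResolutionOfSingularities.ResolutionOfSingularities.Theorems.FRationalResolution.StratumDescent

universe u w

variable {k : Type u} [Field k] {A : Type w} [DecidableEq A] [AddCommGroup A] {S : Type u}
  [CommRing S] [Algebra k S] (𝒮 : A → Submodule k S) [GradedAlgebra 𝒮]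
  {n : ℕ} (x : Fin n → S) (a : Fin n → A) (hx : ∀ i, x i ∈ 𝒮 (a i))

/-- Powers of a degree-zero element are of degree zero. [folklore] -/
theorem powers_le_gradeZero (e : 𝒮 0) : ∀ t ∈ Submonoid.powers (e : S), t ∈ 𝒮 0 := by
  rintro _ ⟨m, rfl⟩
  have h := SetLike.pow_mem_graded m e.2
  rwa [smul_zero] at h

include hx in
/-- **The stratum quotient is flat over the degree-zero quotient on `S[e⁻¹]`.** With `L = S[e⁻¹]`
graded by `ℒ = locPiece`, `I_L = (x_I)L`: if `g • S ⊆ S₀[x]`, `g ∣ e` and `x_j ∣ e` for `j ∉ I`, then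
`L ⧸ I_L` is flat over `ℒ 0 ⧸ (I_L ∩ ℒ 0)`. [folklore; cite: SGA3, Exp. VIII §4–5] -/
theorem flat_stratum_quotient (I : Finset (Fin n)) (g : 𝒮 0)
    (hgen : ∀ s : S, (g : S) * s ∈ Algebra.adjoin (𝒮 0) (Set.range x)) (e : 𝒮 0)
    (hge : (g : S) ∣ (e : S)) (hxe : ∀ j ∉ I, x j ∣ (e : S))
    (L : Type u) [CommRing L] [Algebra S L] [Algebra k L] [IsScalarTower k S L]
    [IsLocalization (Submonoid.powers (e : S)) L] :
    letI := gradedMonoid_locPiece 𝒮 (Submonoid.powers (e : S)) (powers_le_gradeZero 𝒮 e) L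
    letI := locPieceZeroAlgebra 𝒮 (Submonoid.powers (e : S)) (powers_le_gradeZero 𝒮 e) L
    Module.Flat
      (locPiece 𝒮 (Submonoid.powers (e : S)) (powers_le_gradeZero 𝒮 e) L 0 ⧸
        ((Ideal.span (x '' (↑I : Set (Fin n)))).map (algebraMap S L)).comap
          (algebraMap (locPiece 𝒮 (Submonoid.powers (e : S)) (powers_le_gradeZero 𝒮 e) L 0) L))
      (L ⧸ (Ideal.span (x '' (↑I : Set (Fin n)))).map (algebraMap S L)) := by
  classical
  set T : Submonoid S := Submonoid.powers (e : S) with hTdef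
  have hT : ∀ t ∈ T, t ∈ 𝒮 0 := powers_le_gradeZero 𝒮 e
  let ℒ := locPiece 𝒮 T hT L
  letI : GradedAlgebra ℒ := (nonempty_gradedAlgebra_locPiece 𝒮 T hT L).some
  letI := locPieceZeroAlgebra 𝒮 T hT L
  set IS : Ideal S := Ideal.span (x '' (↑I : Set (Fin n))) with hIS
  set IL : Ideal L := IS.map (algebraMap S L) with hIL
  -- homogeneity of `IL`
  have hILspan : IL = Ideal.span (algebraMap S L '' (x '' (↑I : Set (Fin n)))) := by
    rw [hIL, hIS, Ideal.map_span]
  have hIhom : IL.IsHomogeneous ℒ := by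
    rw [hILspan]
    refine Ideal.homogeneous_span ℒ _ ?_
    rintro _ ⟨_, ⟨i, -, rfl⟩, rfl⟩
    exact ⟨a i, algebraMap_mem_locPiece hT (hx i)⟩
  -- units
  have heunit : IsUnit (algebraMap S L (e : S)) := IsLocalization.Away.algebraMap_isUnit (e : S)
  have hgunit : IsUnit (algebraMap S L (g : S)) :=
    isUnit_of_dvd_unit (map_dvd (algebraMap S L) hge) heunit
  have hxunit : ∀ j ∉ I, IsUnit (algebraMap S L (x j)) := fun j hj =>
    isUnit_of_dvd_unit (map_dvd (algebraMap S L) (hxe j hj)) heunit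
  -- support degrees and their unit monomials
  let D : Set A := {c | ∃ m : Fin n → ℕ, (∀ i ∈ I, m i = 0) ∧ ∑ i, m i • a i = c}
  have hD : ∀ c ∈ D, ∃ m : Fin n → ℕ, (∀ i ∈ I, m i = 0) ∧ ∑ i, m i • a i = c := fun c hc => hc
  choose m hmI hmdeg using hD
  let u : A → L := fun c => if hc : c ∈ D then algebraMap S L (∏ i, x i ^ m c hc i) else 0
  have hu : ∀ c ∈ D, u c ∈ ℒ c := by
    intro c hc
    simp only [u, dif_pos hc]
    have h := SetLike.prod_pow_mem_graded 𝒮 (F := Finset.univ) (i := a) (g := x) (m c hc)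
      fun i _ => hx i
    rw [hmdeg c hc] at h
    exact algebraMap_mem_locPiece hT h
  have hunit : ∀ c ∈ D, IsUnit (u c) := by
    intro c hc
    simp only [u, dif_pos hc, map_prod, map_pow]
    refine IsUnit.prod_univ_iff.mpr fun i => ?_
    by_cases hi : i ∈ I
    · rw [hmI c hc i hi, pow_zero]; exact isUnit_one
    · exact (hxunit i hi).pow _
  -- off-support degrees are swallowed
  have hzero : ∀ c ∉ D, (ℒ c : Set L) ⊆ IL := by
    intro c hc y hy
    obtain ⟨t, ht, s, hs, hty⟩ := (mem_locPiece_iff hT).mp hy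
    have hgs : (g : S) * s ∈ IS :=
      OffSupportDegrees.mul_mem_span_of_degree_not_mem 𝒮 x a hx I g hgen c hc s hs
    have hgsL : algebraMap S L ((g : S) * s) ∈ IL := Ideal.mem_map_of_mem _ hgs
    -- `y = (g t)⁻¹ · (g s)` in `L`
    obtain ⟨w, hw⟩ := (hgunit.mul (IsLocalization.map_units L ⟨t, ht⟩)).exists_left_inv
    have hy' : y = w * algebraMap S L ((g : S) * s) := by
      calc y = w * (algebraMap S L (g : S) * algebraMap S L t) * y := by
              rw [show algebraMap S L (↑(⟨t, ht⟩ : T)) = algebraMap S L t from rfl] at hw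
              rw [hw, one_mul]
        _ = w * algebraMap S L ((g : S) * s) := by rw [map_mul, ← hty]; ring
    rw [SetLike.mem_coe, hy']
    exact IL.mul_mem_left w hgsL
  -- `R₀ = ℒ 0`
  have h0 : ∀ r : ℒ 0, algebraMap (ℒ 0) L r ∈ ℒ 0 := fun r => r.2
  have hsurj : ∀ s ∈ ℒ 0, ∃ r : ℒ 0, algebraMap (ℒ 0) L r = s := fun s hs => ⟨⟨s, hs⟩, rfl⟩
  exact GradedQuotientFree.flat_quotient ℒ h0 hsurj IL hIhom D u hu hunit hzero


end Summit.ResolutionOfSingularities.ResolutionOfSingularities.Theorems.FRationalResolution.StratumDescent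

end
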